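import Literature.AlgebraicGeometry.Motives.MixedHodgeStructureIndecomposableDual
import HarnessLib

/-!
# The socle is the smallest essential sub-MHS, the radical the largest superfluous one

Standard structure theory of finite-length objects of an abelian category, here for mixed Hodge structures on
finite-dimensional `ℚ`-spaces (Cattani–El Zein–Griffiths–Lê, *Hodge Theory*, Thm. 3.2.18; semisimple objects
p. 270; duality `S ↦ S^⊥` after Fujiki (1.6.2)): a sub-MHS `S ⊆ H` is *essential* if it meets every non-zero
sub-MHS, *superfluous* if `S + T = H` forces `T = H`.

* §1 **`soc H` is essential** (every non-zero sub-MHS contains a simple one) and lies in every essential sub-MHS;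
  so `soc H` is the intersection of the essential sub-MHS.
* §2 **`rad H` is superfluous** (`rad(H/S) = (rad H + S)/S ≠ H/S` for `S ≠ H`) and contains every superfluous
  sub-MHS (by duality: `S` superfluous ⇒ `S^⊥` essential in `H^∨` ⇒ `soc H^∨ ⊆ S^⊥` ⇒ `S ⊆ (soc H^∨)_⊥ = rad H`).
* §3 consequences: **a morphism is injective iff it is injective on the socle**, **surjective iff its image together
  with the radical spans the target**.

Namespace `MixedHodgeStructure`; everything proved, no named facts.

## References

* [CattaniElZeinGriffithsLe2014] E. Cattani et al. (eds.), Hodge Theory (2014), Thm. 3.2.18, Lemma 3.2.20, p. 270.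
* [Fujiki1980] A. Fujiki, Duality of mixed Hodge structures of algebraic varieties (1980), (1.6.2).
-/

noncomputable section

namespace Literature.AlgebraicGeometry.Motives

namespace MixedHodgeStructure

universe u v

variable {V : Type u} [AddCommGroup V] [Module ℚ V] [FiniteDimensional ℚ V]
variable {V' : Type v} [AddCommGroup V'] [Module ℚ V'] [FiniteDimensional ℚ V']
variable {H : MixedHodgeStructure V} {H' : MixedHodgeStructure V'}

open Module

/-! ### §1 The socle is essential -/

omit [FiniteDimensional ℚ V] in
/-- A simple sub-MHS of `S` (pushed into `H`) is a simple sub-MHS of `H`. [cite: CattaniElZeinGriffithsLe2014, p. 270] -/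
theorem IsSimple.ofSub {S : SubMixedHodgeStructure H} {R : SubMixedHodgeStructure S.toMixedHodgeStructure}
    (h : R.toMixedHodgeStructure.IsSimple) : (S.ofSub R).toMixedHodgeStructure.IsSimple := by
  obtain ⟨f, hf⟩ := S.exists_hom_ofSub_bijective R
  exact h.of_bijective f hf

/-- **Every non-zero sub-MHS contains a simple sub-MHS of `H`.** [cite: CattaniElZeinGriffithsLe2014, Thm. 3.2.18 and p. 270] -/
theorem SubMixedHodgeStructure.exists_le_isSimple (S : SubMixedHodgeStructure H) (hS : S.toSubmodule ≠ ⊥) :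
    ∃ T : SubMixedHodgeStructure H, T.toSubmodule ≤ S.toSubmodule ∧ T.toMixedHodgeStructure.IsSimple := by
  haveI : Nontrivial ↥S.toSubmodule := Submodule.nontrivial_iff_ne_bot.2 hS
  obtain ⟨R, hR⟩ := exists_subMixedHodgeStructure_isSimple S.toMixedHodgeStructure
  exact ⟨S.ofSub R, S.ofSub_toSubmodule_le R, hR.ofSub⟩

/-- **The socle is essential: it meets every non-zero sub-MHS.** [cite: CattaniElZeinGriffithsLe2014, Thm. 3.2.18 and p. 270] -/
theorem inf_socle_ne_bot (S : SubMixedHodgeStructure H) (hS : S.toSubmodule ≠ ⊥) :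
    S.toSubmodule ⊓ (socle H).toSubmodule ≠ ⊥ := by
  obtain ⟨T, hTS, hT⟩ := S.exists_le_isSimple hS
  haveI := hT.nontrivial
  have hTne : T.toSubmodule ≠ ⊥ := Submodule.nontrivial_iff_ne_bot.1 inferInstance
  exact fun h => hTne (le_bot_iff.1 (h ▸ le_inf hTS (le_socle_of_isSimple T hT)))

/-- **The socle lies in every essential sub-MHS** (a simple `T` meets `S`, hence `T ⊆ S`). [cite: CattaniElZeinGriffithsLe2014, p. 270] -/
theorem socle_le_of_forall_inf_ne_bot (S : SubMixedHodgeStructure H)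
    (hS : ∀ T : SubMixedHodgeStructure H, T.toSubmodule ≠ ⊥ → T.toSubmodule ⊓ S.toSubmodule ≠ ⊥) :
    (socle H).toSubmodule ≤ S.toSubmodule := by
  rw [socle_toSubmodule_eq_iSup]
  refine iSup_le fun T => ?_
  obtain ⟨T, hT⟩ := T
  haveI := hT.nontrivial
  have hTne : T.toSubmodule ≠ ⊥ := Submodule.nontrivial_iff_ne_bot.1 inferInstance
  rcases hT.eq_bot_or_eq_top (S.comap T.subtype) with h | h <;> rw [SubMixedHodgeStructure.comap_toSubmodule] at h
  · refine absurd (eq_bot_iff.2 fun x hx => ?_) (hS T hTne)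
    have hx' : (⟨x, hx.1⟩ : ↥T.toSubmodule) ∈ S.toSubmodule.comap T.subtype.toLinearMap := hx.2
    rw [h, Submodule.mem_bot] at hx'
    rw [Submodule.mem_bot]
    exact congrArg Subtype.val hx'
  · intro x hx
    have hx' : (⟨x, hx⟩ : ↥T.toSubmodule) ∈ S.toSubmodule.comap T.subtype.toLinearMap := by rw [h]; exact Submodule.mem_top
    exact hx'

/-- **`soc H` is the intersection of the essential sub-MHS.** [cite: CattaniElZeinGriffithsLe2014, p. 270] -/
theorem socle_toSubmodule_eq_iInf_essential : (socle H).toSubmodule =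
    ⨅ S : {S : SubMixedHodgeStructure H //
      ∀ T : SubMixedHodgeStructure H, T.toSubmodule ≠ ⊥ → T.toSubmodule ⊓ S.toSubmodule ≠ ⊥}, S.1.toSubmodule :=
  le_antisymm (le_iInf fun S => socle_le_of_forall_inf_ne_bot S.1 S.2) (iInf_le_of_le ⟨socle H, inf_socle_ne_bot⟩ le_rfl)

/-! ### §2 The radical is superfluous -/

/-- **The radical is superfluous: `S + rad H = H` forces `S = H`** (`rad(H/S) = image of rad H` would be all of the
non-zero `H/S`). [cite: CattaniElZeinGriffithsLe2014, Thm. 3.2.18 and p. 270] -/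
theorem eq_top_of_sup_radical_eq_top (S : SubMixedHodgeStructure H)
    (h : S.toSubmodule ⊔ (radical H).toSubmodule = ⊤) : S.toSubmodule = ⊤ := by
  by_contra hS
  haveI : Nontrivial (V ⧸ S.toSubmodule) := Submodule.Quotient.nontrivial_iff.2 hS
  apply radical_ne_top (H := S.quotient)
  rw [← SubMixedHodgeStructure.map_mkQ_radical, ← bot_sup_eq ((radical H).toSubmodule.map _),
    ← Submodule.mkQ_map_self S.toSubmodule, ← Submodule.map_sup, h, Submodule.map_top, Submodule.range_mkQ]

/-- A superfluous sub-MHS has essential orthogonal. [cite: Fujiki1980, (1.6.2) b)] [cite: CattaniElZeinGriffithsLe2014, p. 270] -/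
theorem SubMixedHodgeStructure.inf_annihilator_ne_bot_of_superfluous (S : SubMixedHodgeStructure H)
    (hS : ∀ T : SubMixedHodgeStructure H, T.toSubmodule ⊔ S.toSubmodule = ⊤ → T.toSubmodule = ⊤)
    (T' : SubMixedHodgeStructure H.dual) (hT' : T'.toSubmodule ≠ ⊥) :
    T'.toSubmodule ⊓ S.annihilator.toSubmodule ≠ ⊥ := by
  intro h
  -- `(T'_⊥ + S)^⊥ = T' ∩ S^⊥ = 0`, so `T'_⊥ + S = H`, so `T'_⊥ = H`, so `T' = 0`
  have h1 : (T'.coannihilator.sup S).annihilator = bot H.dual :=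
    SubMixedHodgeStructure.ext (by
      rw [annihilator_sup, annihilator_coannihilator, inf_toSubmodule, h, bot_toSubmodule])
  have h2 := eq_top_of_annihilator_eq_bot _ h1
  have h3 : T'.coannihilator.toSubmodule = ⊤ := hS _ (by rw [← sup_toSubmodule, h2, top_toSubmodule])
  apply hT'
  rw [← annihilator_coannihilator T', show T'.coannihilator = top H from ext (by rw [h3, top_toSubmodule]),
    annihilator_top, bot_toSubmodule]

/-- **The radical contains every superfluous sub-MHS** (`S^⊥` is essential in `H^∨`, so `soc H^∨ ⊆ S^⊥` and
`S = (S^⊥)_⊥ ⊆ (soc H^∨)_⊥ = rad H`). [cite: Fujiki1980, (1.6.2) b)] [cite: CattaniElZeinGriffithsLe2014, p. 270] -/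
theorem le_radical_of_forall_sup_eq_top (S : SubMixedHodgeStructure H)
    (hS : ∀ T : SubMixedHodgeStructure H, T.toSubmodule ⊔ S.toSubmodule = ⊤ → T.toSubmodule = ⊤) :
    S.toSubmodule ≤ (radical H).toSubmodule := by
  have h1 : (socle H.dual).toSubmodule ≤ S.annihilator.toSubmodule :=
    socle_le_of_forall_inf_ne_bot S.annihilator (S.inf_annihilator_ne_bot_of_superfluous hS)
  rw [← coannihilator_socle, ← SubMixedHodgeStructure.coannihilator_annihilator S,
    SubMixedHodgeStructure.coannihilator_le_coannihilator_iff]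
  exact h1

/-- **`rad H` is the sum of the superfluous sub-MHS.** [cite: CattaniElZeinGriffithsLe2014, p. 270] -/
theorem radical_toSubmodule_eq_iSup_superfluous : (radical H).toSubmodule =
    ⨆ S : {S : SubMixedHodgeStructure H //
      ∀ T : SubMixedHodgeStructure H, T.toSubmodule ⊔ S.toSubmodule = ⊤ → T.toSubmodule = ⊤}, S.1.toSubmodule :=
  le_antisymm (le_iSup_of_le ⟨radical H, eq_top_of_sup_radical_eq_top⟩ le_rfl)
    (iSup_le fun S => le_radical_of_forall_sup_eq_top S.1 S.2)

/-! ### §3 Injectivity is detected on the socle, surjectivity modulo the radical -/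

omit [FiniteDimensional ℚ V'] in
/-- **A morphism of MHS is injective iff it is injective on the socle** (`Ker f` is a sub-MHS; if non-zero it meets
`soc H`). [cite: CattaniElZeinGriffithsLe2014, Thm. 3.2.18 and p. 270] -/
theorem Hom.injective_iff_injective_comp_socle_subtype (f : Hom H H') :
    Function.Injective f.toLinearMap ↔ Function.Injective (f.comp (socle H).subtype).toLinearMap := by
  refine ⟨fun h => h.comp (Submodule.injective_subtype _), fun h => ?_⟩
  rw [← LinearMap.ker_eq_bot, ← Hom.ker_toSubmodule]
  by_contra hk
  obtain ⟨x, hx, hx0⟩ := Submodule.exists_mem_ne_zero_of_ne_bot (inf_socle_ne_bot f.ker hk)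
  obtain ⟨hxk, hxs⟩ := Submodule.mem_inf.1 hx
  rw [Hom.ker_toSubmodule, LinearMap.mem_ker] at hxk
  have h0 : (f.comp (socle H).subtype).toLinearMap ⟨x, hxs⟩ = (f.comp (socle H).subtype).toLinearMap 0 := by
    rw [map_zero]; exact hxk
  exact hx0 (congrArg Subtype.val (h h0))

omit [FiniteDimensional ℚ V'] in
/-- `Ker f ∩ soc H = 0 ⇒ f` injective. [cite: CattaniElZeinGriffithsLe2014, Thm. 3.2.18 and p. 270] -/
theorem Hom.injective_of_ker_inf_socle_eq_bot (f : Hom H H') (h : f.ker.toSubmodule ⊓ (socle H).toSubmodule = ⊥) :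
    Function.Injective f.toLinearMap := by
  rw [← LinearMap.ker_eq_bot, ← Hom.ker_toSubmodule]
  by_contra hk
  exact inf_socle_ne_bot f.ker hk h

omit [FiniteDimensional ℚ V] in
/-- **A morphism of MHS is surjective iff `Im f + rad H' = H'`.** [cite: CattaniElZeinGriffithsLe2014, Thm. 3.2.18 and p. 270] -/
theorem Hom.surjective_iff_range_sup_radical_eq_top (f : Hom H H') :
    Function.Surjective f.toLinearMap ↔ LinearMap.range f.toLinearMap ⊔ (radical H').toSubmodule = ⊤ := by
  refine ⟨fun h => ?_, fun h => ?_⟩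
  · rw [LinearMap.range_eq_top.2 h, top_sup_eq]
  · rw [← LinearMap.range_eq_top, ← Hom.range_toSubmodule]
    exact eq_top_of_sup_radical_eq_top f.range (by rw [Hom.range_toSubmodule]; exact h)

end MixedHodgeStructure

end Literature.AlgebraicGeometry.Motives
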